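import Summits.ResolutionOfSingularities.ResolutionOfSingularities.Theorems.PurelyInseparableDim4PureLeafSplitForms
import Summits.ResolutionOfSingularities.ResolutionOfSingularities.Theorems.PurelyInseparableDim4MohAlong
import HarnessLib
import HarnessLib.Audit.Tags

/-!
# Purely inseparable fourfolds — THE GENERAL FORM `expand_p N(n) · (N(μ) − γ)` of the pure-leaf class over `𝔽_p`
# (cell res-dim4-pi; D3c kit F of `HOME/res-dim4-p-10/D3c-PAPER.md`: one shape for product states AND L-states)
# [OURS · counted 0 · bookkeeping identities of OUR frame, not about resolution]

Width seat `res-dim4-p-10` (g3).  With the split form `N(m) = ∏ᵢ ∏_{c : ZMod p} (Xᵢ + C c)^{m i c}` of kit E, every state of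
the conjectured pure-leaf class over `𝔽_p` (product states of regime (ii) and L-states alike) is ONE shape
    `GF(n, μ; γ₀) = expand p N(n) · (N(μ) − C γ₀)`,   `μ i c < p`, at most one `μ i c ≠ 0` per variable,
with `γ₀ = γ(μ) := ∏ᵢ ∏_c c^{μ i c}` after a cleaning: `γ(μ) = 0` iff some variable is PURE (`μ i 0 ≠ 0`), and then
`GF = N(p·n + μ)` is a product state; otherwise it is an L-state (bracket `N(μ) − γ(μ)`, `|T(μ)| ≥ 2`) or a lone clean
factor (`|T(μ)| = 1`).  This file proves the uniform algebra of the moves on this shape: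

* §1 `expand_splitForm`, `expand_splitForm_mul_splitForm` (`expand N(n)·N(μ) = N(p n + μ)`), `gamma_eq_zero_iff`;
* §2 `translate_expand` (translations commute with `expand p` over `𝔽_p`), `translate_generalForm` (both exponent arrays are
  ROOT-SHIFTED, the constant `γ₀` is kept);
* §3 `expand_splitForm_eq_X_pow_mul`, `chartTransform_singleton_generalForm` (the chart `{x_j}` lowers `n j 0` by one);
* §4 `sub_deletePthPowers_splitForm_small` (`N(μ) − del N(μ) = C γ(μ)` for small single-rooted `μ`), `deletePthPowers_sub`,
  `deletePthPowers_C`, **`deletePthPowers_generalForm`**: `del (expand N(n)·(N(μ) − C γ₀)) = expand N(n)·(N(μ) − C γ(μ))` for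
  EVERY constant `γ₀` — the cleaning only RENORMALISES the constant;
* §5 **`step_singleton_generalForm`** — the whole singleton move: `(step p {j} j b s).F = GF(n₂, μ₂; γ(μ₂))` with `n₂`, `μ₂` the
  root shifts of `n − δ_{(j,0)}`, `μ`.

The block charts of pure monomial variables (centres of cardinality ≥ 2), the lone-clean-factor regime and the game theorem
are NOT in this file.  Nothing here proves resolution of singularities in dimension ≥ 4 / characteristic `p`; counted 0; AI
work, weaker than expert review. bears_on: LADDER-RESOLUTION:D157-DOOR2 (res-dim4-pi · D3c kit F). Supports
stmt-ResolutionOfSingularities-16155 (helper).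
-/

set_option linter.dupNamespace false

open MvPolynomial Finset

open scoped BigOperators

noncomputable section

namespace Summit.ResolutionOfSingularities.ResolutionOfSingularities.Theorems.PIDim4

namespace PureLeafNF

open Literature.AlgebraicGeometry.Resolution
open Literature.AlgebraicGeometry.Resolution.Hauser2010
open CentreBlowup PthPowerFactor

variable {σ : Type*} [Fintype σ] [DecidableEq σ] (p : ℕ) [Fact p.Prime]

/-! ## 1. The general form -/

omit [DecidableEq σ] in
/-- `expand p N(n) = N(p·n)`. [folklore] -/
theorem expand_splitForm (n : σ → ZMod p → ℕ) :
    expand p (∏ i, ∏ c, (X i + C c) ^ n i c : MvPolynomial σ (ZMod p)) = ∏ i, ∏ c, (X i + C c) ^ (p * n i c) := by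
  rw [map_prod]
  refine Finset.prod_congr rfl fun i _ => ?_
  rw [map_prod]
  refine Finset.prod_congr rfl fun c _ => ?_
  rw [linear_pow_mul_eq_expand]

omit [DecidableEq σ] in
/-- **`expand p N(n) · N(μ) = N(p·n + μ)`.** [folklore] -/
theorem expand_splitForm_mul_splitForm (n μ : σ → ZMod p → ℕ) :
    expand p (∏ i, ∏ c, (X i + C c) ^ n i c : MvPolynomial σ (ZMod p)) * ∏ i, ∏ c, (X i + C c) ^ μ i c =
      ∏ i, ∏ c, (X i + C c) ^ (p * n i c + μ i c) := by
  rw [expand_splitForm, ← Finset.prod_mul_distrib]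
  refine Finset.prod_congr rfl fun i _ => ?_
  rw [← Finset.prod_mul_distrib]
  refine Finset.prod_congr rfl fun c _ => ?_
  rw [pow_add]

omit [DecidableEq σ] in
/-- **`γ(μ) = ∏ᵢ ∏_c c^{μ i c}` vanishes iff some variable is pure** (`μ i 0 ≠ 0`). [folklore] -/
theorem gamma_eq_zero_iff (μ : σ → ZMod p → ℕ) :
    (∏ i, ∏ c, (c : ZMod p) ^ μ i c) = 0 ↔ ∃ i, μ i 0 ≠ 0 := by
  constructor
  · intro h
    obtain ⟨i, -, hi⟩ := Finset.prod_eq_zero_iff.mp h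
    obtain ⟨c, -, hc⟩ := Finset.prod_eq_zero_iff.mp hi
    have hne : μ i c ≠ 0 := by rintro h0; rw [h0, pow_zero] at hc; exact one_ne_zero hc
    have hc0 : c = 0 := (pow_eq_zero_iff hne).mp hc
    exact ⟨i, by rw [hc0] at hne; exact hne⟩
  · rintro ⟨i, hi⟩
    exact Finset.prod_eq_zero (Finset.mem_univ i)
      (Finset.prod_eq_zero (Finset.mem_univ (0 : ZMod p)) (zero_pow hi))

omit [DecidableEq σ] in
/-- **The product case**: if `γ(μ) = 0` then `GF(n, μ; 0… ) = expand N(n)·N(μ) = N(p n + μ)`; stated with the constant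
`C 0`. [folklore] -/
theorem generalForm_C_zero (n μ : σ → ZMod p → ℕ) :
    expand p (∏ i, ∏ c, (X i + C c) ^ n i c : MvPolynomial σ (ZMod p)) *
        ((∏ i, ∏ c, (X i + C c) ^ μ i c) - C 0) =
      ∏ i, ∏ c, (X i + C c) ^ (p * n i c + μ i c) := by
  rw [C_0, sub_zero, expand_splitForm_mul_splitForm]

/-! ## 2. Translations -/

omit [Fintype σ] [DecidableEq σ] in
/-- **Translations commute with `expand p` over `𝔽_p`** (`(Xᵢ + bᵢ)^p = Xᵢ^p + bᵢ`). [folklore] -/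
theorem translate_expand (b : σ → ZMod p) (G : MvPolynomial σ (ZMod p)) :
    PointBlowup.translate b (expand p G) = expand p (PointBlowup.translate b G) := by
  unfold PointBlowup.translate
  have h : (aeval fun i => (X i + C (b i) : MvPolynomial σ (ZMod p))).comp (expand p) =
      (expand p).comp (aeval fun i => (X i + C (b i) : MvPolynomial σ (ZMod p))) := by
    refine MvPolynomial.algHom_ext fun i => ?_
    rw [AlgHom.comp_apply, AlgHom.comp_apply, expand_X, map_pow, aeval_X, map_add, expand_X, expand_C,
      linear_pow_char]
  exact congrArg (fun φ : MvPolynomial σ (ZMod p) →ₐ[ZMod p] MvPolynomial σ (ZMod p) => φ G) h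

omit [DecidableEq σ] in
/-- **Translating the general form**: both exponent arrays are root-shifted, the constant is kept. [folklore] -/
theorem translate_generalForm (b : σ → ZMod p) (n μ : σ → ZMod p → ℕ) (γ₀ : ZMod p) :
    PointBlowup.translate b (expand p (∏ i, ∏ c, (X i + C c) ^ n i c : MvPolynomial σ (ZMod p)) *
        ((∏ i, ∏ c, (X i + C c) ^ μ i c) - C γ₀)) =
      expand p (∏ i, ∏ c, (X i + C c) ^ n i (c - b i) : MvPolynomial σ (ZMod p)) *
        ((∏ i, ∏ c, (X i + C c) ^ μ i (c - b i)) - C γ₀) := by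
  have hC : PointBlowup.translate b (C γ₀ : MvPolynomial σ (ZMod p)) = C γ₀ := by
    unfold PointBlowup.translate; rw [aeval_C, algebraMap_eq]
  have hsub : ∀ P Q : MvPolynomial σ (ZMod p),
      PointBlowup.translate b (P - Q) = PointBlowup.translate b P - PointBlowup.translate b Q := fun P Q => by
    unfold PointBlowup.translate; rw [map_sub]
  rw [MohAlong.translate_mul, translate_expand, translate_splitForm, hsub, translate_splitForm, hC]

/-! ## 3. The singleton chart -/

omit [DecidableEq σ] in
/-- Pulling one `X_j` out of `N(n)` (`1 ≤ n j 0`). [folklore] -/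
theorem splitForm_eq_X_mul [DecidableEq σ] (n : σ → ZMod p → ℕ) {j : σ} (hj : 1 ≤ n j 0) :
    (∏ i, ∏ c, (X i + C c) ^ n i c : MvPolynomial σ (ZMod p)) =
      X j * ∏ i, ∏ c, (X i + C c) ^ (if i = j ∧ c = 0 then n j 0 - 1 else n i c) := by
  rw [← Finset.mul_prod_erase Finset.univ _ (Finset.mem_univ j),
    ← Finset.mul_prod_erase Finset.univ (fun i => ∏ c, (X i + C c : MvPolynomial σ (ZMod p)) ^
      (if i = j ∧ c = 0 then n j 0 - 1 else n i c)) (Finset.mem_univ j)]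
  have hrest : ∏ i ∈ Finset.univ.erase j, ∏ c, (X i + C c : MvPolynomial σ (ZMod p)) ^ n i c =
      ∏ i ∈ Finset.univ.erase j, ∏ c, (X i + C c : MvPolynomial σ (ZMod p)) ^
        (if i = j ∧ c = 0 then n j 0 - 1 else n i c) :=
    Finset.prod_congr rfl fun i hi => Finset.prod_congr rfl fun c _ => by
      rw [if_neg (fun h => Finset.ne_of_mem_erase hi h.1)]
  rw [hrest, ← mul_assoc]
  congr 1
  rw [← Finset.mul_prod_erase Finset.univ _ (Finset.mem_univ (0 : ZMod p)),
    ← Finset.mul_prod_erase Finset.univ (fun c => (X j + C c : MvPolynomial σ (ZMod p)) ^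
      (if j = j ∧ c = 0 then n j 0 - 1 else n j c)) (Finset.mem_univ (0 : ZMod p))]
  have hrest' : ∏ c ∈ Finset.univ.erase (0 : ZMod p), (X j + C c : MvPolynomial σ (ZMod p)) ^ n j c =
      ∏ c ∈ Finset.univ.erase (0 : ZMod p), (X j + C c : MvPolynomial σ (ZMod p)) ^
        (if j = j ∧ c = 0 then n j 0 - 1 else n j c) :=
    Finset.prod_congr rfl fun c hc => by rw [if_neg (fun h => Finset.ne_of_mem_erase hc h.2)]
  rw [hrest', ← mul_assoc, if_pos ⟨rfl, rfl⟩, C_0, add_zero, ← pow_succ', Nat.sub_add_cancel hj]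

/-- **`expand N(n) = X_j^p · expand N(n − δ_{(j,0)})`** (`1 ≤ n j 0`). [folklore] -/
theorem expand_splitForm_eq_X_pow_mul (n : σ → ZMod p → ℕ) {j : σ} (hj : 1 ≤ n j 0) :
    expand p (∏ i, ∏ c, (X i + C c) ^ n i c : MvPolynomial σ (ZMod p)) =
      X j ^ p * expand p (∏ i, ∏ c, (X i + C c) ^ (if i = j ∧ c = 0 then n j 0 - 1 else n i c)) := by
  rw [splitForm_eq_X_mul p n hj, map_mul, expand_X]

/-- **The singleton chart on the general form** lowers `n j 0` by one. [folklore] -/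
theorem chartTransform_singleton_generalForm (n μ : σ → ZMod p → ℕ) (γ₀ : ZMod p) {j : σ} (hj : 1 ≤ n j 0) :
    chartTransform p {j} j (expand p (∏ i, ∏ c, (X i + C c) ^ n i c : MvPolynomial σ (ZMod p)) *
        ((∏ i, ∏ c, (X i + C c) ^ μ i c) - C γ₀)) =
      expand p (∏ i, ∏ c, (X i + C c) ^ (if i = j ∧ c = 0 then n j 0 - 1 else n i c) : MvPolynomial σ (ZMod p)) *
        ((∏ i, ∏ c, (X i + C c) ^ μ i c) - C γ₀) := by
  rw [expand_splitForm_eq_X_pow_mul p n hj, mul_assoc, chartTransform_singleton_mul]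

/-! ## 4. Cleaning renormalises the constant -/

/-- **`N(μ) − del N(μ) = C γ(μ)`** for a small single-rooted `μ` (`μ i c < p`; at most one `μ i c ≠ 0` per variable). [folklore] -/
theorem sub_deletePthPowers_splitForm_small (μ : σ → ZMod p → ℕ) (hμ : ∀ i c, μ i c < p)
    (h1 : ∀ i c, μ i c ≠ 0 → ∀ c', c' ≠ c → μ i c' = 0) :
    (∏ i, ∏ c, (X i + C c) ^ μ i c : MvPolynomial σ (ZMod p)) - deletePthPowers p (∏ i, ∏ c, (X i + C c) ^ μ i c) =
      C (∏ i, ∏ c, (c : ZMod p) ^ μ i c) := by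
  have h := sub_deletePthPowers_prod_linearFactors (K := ZMod p) p Finset.univ Finset.univ (fun c : ZMod p => c) μ
  rw [h, map_prod]
  refine Finset.prod_congr rfl fun i _ => ?_
  -- the residue factor of the variable `i` is a single short linear power
  by_cases hex : ∃ c, μ i c ≠ 0
  · obtain ⟨c₀, hc₀⟩ := hex
    have hfac : (∏ c, (X i + C c) ^ μ i c : MvPolynomial σ (ZMod p)) = (X i + C c₀) ^ μ i c₀ := by
      rw [← Finset.mul_prod_erase Finset.univ _ (Finset.mem_univ c₀), Finset.prod_eq_one fun c hc => ?_, mul_one]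
      rw [h1 i c₀ hc₀ c (Finset.ne_of_mem_erase hc), pow_zero]
    have hγ : (∏ c, (c : ZMod p) ^ μ i c) = c₀ ^ μ i c₀ := by
      rw [← Finset.mul_prod_erase Finset.univ _ (Finset.mem_univ c₀), Finset.prod_eq_one fun c hc => ?_, mul_one]
      rw [h1 i c₀ hc₀ c (Finset.ne_of_mem_erase hc), pow_zero]
    rw [hfac, hγ, sub_deletePthPowers_linearPow p i c₀ (hμ i c₀)]
  · push Not at hex
    have hfac : (∏ c, (X i + C c) ^ μ i c : MvPolynomial σ (ZMod p)) = (X i + C 0) ^ (0 : ℕ) := by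
      rw [pow_zero]; exact Finset.prod_eq_one fun c _ => by rw [hex c, pow_zero]
    have hγ : (∏ c, (c : ZMod p) ^ μ i c) = (0 : ZMod p) ^ (0 : ℕ) := by
      rw [pow_zero]; exact Finset.prod_eq_one fun c _ => by rw [hex c, pow_zero]
    rw [hfac, hγ, sub_deletePthPowers_linearPow p i 0 (Fact.out : p.Prime).pos]

omit [Fintype σ] in
/-- Deleting `q`-th power monomials commutes with subtraction. [folklore] -/
theorem deletePthPowers_sub {L : Type*} [CommRing L] (q : ℕ) (P Q : MvPolynomial σ L) :
    deletePthPowers q (P - Q) = deletePthPowers q P - deletePthPowers q Q := by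
  ext d
  simp only [coeff_deletePthPowers, coeff_sub]
  split_ifs <;> simp

omit [Fintype σ] in
/-- A constant is a `q`-th power monomial: it is deleted. [folklore] -/
theorem deletePthPowers_C {L : Type*} [CommRing L] (q : ℕ) (a : L) :
    deletePthPowers q (C a : MvPolynomial σ L) = 0 := by
  rw [← monomial_zero', deletePthPowers_monomial, if_pos]
  intro i hi
  rw [Finsupp.support_zero] at hi
  exact absurd hi (Finset.notMem_empty i)

/-- **THE CLEANING OF THE GENERAL FORM RENORMALISES THE CONSTANT**: for every `γ₀`,
`del (expand N(n)·(N(μ) − C γ₀)) = expand N(n)·(N(μ) − C γ(μ))`. [folklore] -/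
theorem deletePthPowers_generalForm (n μ : σ → ZMod p → ℕ) (γ₀ : ZMod p) (hμ : ∀ i c, μ i c < p)
    (h1 : ∀ i c, μ i c ≠ 0 → ∀ c', c' ≠ c → μ i c' = 0) :
    deletePthPowers p (expand p (∏ i, ∏ c, (X i + C c) ^ n i c : MvPolynomial σ (ZMod p)) *
        ((∏ i, ∏ c, (X i + C c) ^ μ i c) - C γ₀)) =
      expand p (∏ i, ∏ c, (X i + C c) ^ n i c : MvPolynomial σ (ZMod p)) *
        ((∏ i, ∏ c, (X i + C c) ^ μ i c) - C (∏ i, ∏ c, (c : ZMod p) ^ μ i c)) := by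
  rw [deletePthPowers_mul_of_forall_dvd p _ _ (forall_dvd_of_mem_support_expand_splitForm p n), deletePthPowers_sub,
    deletePthPowers_C, sub_zero]
  congr 1
  have h := sub_deletePthPowers_splitForm_small p μ hμ h1
  linear_combination -h

/-! ## 5. The singleton move on the general form -/

omit [Fintype σ] [DecidableEq σ] [Fact p.Prime] in
/-- Root shifts keep `μ i c < N`. [folklore] -/
theorem small_shift {R : Type*} [AddGroup R] {N : ℕ} {μ : σ → R → ℕ} (hμ : ∀ i c, μ i c < N) (b : σ → R) :
    ∀ i c, μ i (c - b i) < N := fun i c => hμ i (c - b i)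

omit [Fintype σ] [DecidableEq σ] [Fact p.Prime] in
/-- Root shifts keep «at most one active root per variable». [folklore] -/
theorem singleRoot_shift {R : Type*} [AddGroup R] {μ : σ → R → ℕ}
    (h1 : ∀ i c, μ i c ≠ 0 → ∀ c', c' ≠ c → μ i c' = 0) (b : σ → R) :
    ∀ i c, μ i (c - b i) ≠ 0 → ∀ c', c' ≠ c → μ i (c' - b i) = 0 :=
  fun i c hc c' hc' => h1 i (c - b i) hc (c' - b i) (fun h => hc' (sub_left_injective h))

/-- **THE SINGLETON MOVE on the general form.** State `F = expand N(n)·(N(μ) − C γ₀)` (`μ` small and single-rooted),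
centre `{x_j}` with `1 ≤ n j 0`, ANY reply `b`: the cleaned transform is `expand N(n₂)·(N(μ₂) − C γ(μ₂))` with `n₂`, `μ₂`
the root shifts of `n − δ_{(j,0)}` and `μ`. [OURS · counted 0] [folklore] -/
theorem step_singleton_generalForm (s : CState σ (ZMod p)) (n μ : σ → ZMod p → ℕ) (γ₀ : ZMod p)
    (hF : s.F = expand p (∏ i, ∏ c, (X i + C c) ^ n i c : MvPolynomial σ (ZMod p)) *
      ((∏ i, ∏ c, (X i + C c) ^ μ i c) - C γ₀))
    (hμ : ∀ i c, μ i c < p) (h1 : ∀ i c, μ i c ≠ 0 → ∀ c', c' ≠ c → μ i c' = 0) {j : σ} (hj : 1 ≤ n j 0)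
    (b : σ → ZMod p) :
    (step p {j} j b s).F =
      expand p (∏ i, ∏ c, (X i + C c) ^ (if i = j ∧ c - b i = 0 then n j 0 - 1 else n i (c - b i)) :
          MvPolynomial σ (ZMod p)) *
        ((∏ i, ∏ c, (X i + C c) ^ μ i (c - b i)) - C (∏ i, ∏ c, (c : ZMod p) ^ μ i (c - b i))) := by
  change deletePthPowers p (PointBlowup.translate b (chartTransform p {j} j s.F)) = _
  rw [hF, chartTransform_singleton_generalForm p n μ γ₀ hj, translate_generalForm]
  exact deletePthPowers_generalForm p (fun i c => if i = j ∧ c - b i = 0 then n j 0 - 1 else n i (c - b i))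
    (fun i c => μ i (c - b i)) γ₀ (small_shift hμ b) (singleRoot_shift h1 b)

end PureLeafNF

end Summit.ResolutionOfSingularities.ResolutionOfSingularities.Theorems.PIDim4

end
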